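import Literature.NumberTheory.Automorphic.RelNormOneTorusArch
import HarnessLib

/-!
# `U(W)(L⁺ ⊗ ℝ) ≅ ∏_w U(1)`: the archimedean torus of a CM hermitian line IS the product of circles

Topic `NumberTheory/Automorphic`; namespace `Literature.NumberTheory.Automorphic`.  File `RelNormOneTorusArch`
embeds the compact archimedean torus `relNormOneInfUnits L⁺ L = {y ∈ L_∞ˣ : y ȳ = 1}` of a CM field `L` into
`∏_{w ∣ ∞} U(1)` by the weight characters `archPlaceChars L : y ↦ (ι_w(y_w))_w` (injective, continuous).  Here the
embedding is shown to be ONTO, giving the identification of topological groups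

* `archPlaceChars_surjective`, `archPlaceChars_bijective`;
* `relNormOneInfUnitsEquivCircles L : relNormOneInfUnits L⁺ L ≃ₜ* (InfinitePlace L → Circle)` (with the `MulEquiv`
  `relNormOneInfUnitsMulEquivCircles` and the `Homeomorph` `relNormOneInfUnitsHomeomorphCircles`: a continuous bijection
  from a compact space onto a Hausdorff space).

The one piece of mathematics is the compatibility of the Galois transport of complex conjugation with complex
conjugation of `ℂ` under `ι_w : L_w →+* ℂ` — the tree's
`HeckeCharacter.extensionEmbedding_infSMul` / `extensionEmbedding_galInfiniteCompletionMap_complexConj` — and the fact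
that every infinite place of a CM field is complex, so `ι_w : L_w ≃+* ℂ` (Mathlib `ringEquivComplexOfIsComplex`) and a
family `(z_w)_w` of unit complex numbers lifts to the infinite idele `y = (ι_w⁻¹ z_w)_w` with `y ȳ = 1` (`liftCircles`).
Everything is proved (Mathlib + tree); no named facts.  Port of the HodgeCM publication cell's
`PerL34/NormOneRelTorusCircles` (2026-08-18) re-based on the tree.  Reference for the ambient facts (real points of tori
over `ℝ`, `R_{ℂ/ℝ}^{(1)} 𝔾_m(ℝ) = U(1)`): V. Platonov, A. Rapinchuk, *Algebraic Groups and Number Theory* (1994), § 6.2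
[cite: PlatonovRapinchuk1994, §6.2].
-/

set_option autoImplicit false

noncomputable section

open _root_.Topology _root_.Set _root_.Function
open NumberField InfinitePlace IsDedekindDomain

namespace Literature.NumberTheory.Automorphic

section Circles

variable (L : Type) [Field L] [NumberField L] [IsCMField L]

/-- `ι_w ((c • y)_w) = conj (ι_w (y_w))` for an infinite idele `y` of a CM field (the tree's
`HeckeCharacter.extensionEmbedding_infSMul`, whose `infSMul y` is `c • y` on values). [folklore] -/
theorem extensionEmbedding_complexConj_smul_units_apply (y : (InfiniteAdeleRing L)ˣ) (w : InfinitePlace L) :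
    Completion.extensionEmbedding w ((IsCMField.complexConj L • (y : InfiniteAdeleRing L)) w) =
      starRingEnd ℂ (Completion.extensionEmbedding w ((y : InfiniteAdeleRing L) w)) :=
  GaloisRepresentations.HeckeCharacter.extensionEmbedding_infSMul y w

/-- Every infinite place of the CM field `L` is complex, so `ι_w : L_w ≃+* ℂ`. [folklore] -/
def placeEquivComplex (w : InfinitePlace L) : w.Completion ≃+* ℂ :=
  Completion.ringEquivComplexOfIsComplex (IsTotallyComplex.isComplex w)

/-- `placeEquivComplex` is `ι_w` on values. [folklore] -/
@[simp] theorem placeEquivComplex_apply (w : InfinitePlace L) (t : w.Completion) :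
    placeEquivComplex L w t = Completion.extensionEmbedding w t := rfl

/-- The lift of a family of unit complex numbers to an infinite idele: `y_w = ι_w⁻¹ (z_w)`. [folklore] -/
def liftCircles (z : InfinitePlace L → Circle) : (InfiniteAdeleRing L)ˣ where
  val := fun w => (placeEquivComplex L w).symm (z w)
  inv := fun w => (placeEquivComplex L w).symm ((z w)⁻¹ : Circle)
  val_inv := by
    funext w
    change (placeEquivComplex L w).symm (z w) * (placeEquivComplex L w).symm ((z w)⁻¹ : Circle) = 1
    rw [← map_mul, ← Circle.coe_mul, mul_inv_cancel, Circle.coe_one, map_one]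
  inv_val := by
    funext w
    change (placeEquivComplex L w).symm ((z w)⁻¹ : Circle) * (placeEquivComplex L w).symm (z w) = 1
    rw [← map_mul, ← Circle.coe_mul, inv_mul_cancel, Circle.coe_one, map_one]

/-- Components of the lift. [folklore] -/
theorem liftCircles_apply (z : InfinitePlace L → Circle) (w : InfinitePlace L) :
    ((liftCircles L z : (InfiniteAdeleRing L)ˣ) : InfiniteAdeleRing L) w = (placeEquivComplex L w).symm (z w) :=
  rfl

/-- `ι_w (y_w) = z_w` for the lift `y` of `z`. [folklore] -/
theorem extensionEmbedding_liftCircles (z : InfinitePlace L → Circle) (w : InfinitePlace L) :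
    Completion.extensionEmbedding w (((liftCircles L z : (InfiniteAdeleRing L)ˣ) : InfiniteAdeleRing L) w) =
      z w := by
  rw [liftCircles_apply, ← placeEquivComplex_apply, RingEquiv.apply_symm_apply]

/-- The lift lies in the archimedean torus: `y ȳ = 1`. [folklore] -/
theorem liftCircles_mem (z : InfinitePlace L → Circle) :
    liftCircles L z ∈ relNormOneInfUnits (maximalRealSubfield L) L := by
  rw [mem_relNormOneInfUnits_iff_mul_conj]
  apply Units.ext
  funext w
  change ((liftCircles L z : (InfiniteAdeleRing L)ˣ) : InfiniteAdeleRing L) w *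
      (IsCMField.complexConj L • ((liftCircles L z : (InfiniteAdeleRing L)ˣ) : InfiniteAdeleRing L)) w = 1
  apply (Completion.extensionEmbedding w).injective
  rw [map_mul, extensionEmbedding_complexConj_smul_units_apply, extensionEmbedding_liftCircles, map_one,
    ← Circle.coe_inv_eq_conj, ← Circle.coe_mul, mul_inv_cancel, Circle.coe_one]

/-- **The weight characters are jointly onto `∏_w U(1)`**: every family of unit complex numbers is realised
by a point of `U(W)(L⁺ ⊗ ℝ)`. [cite: PlatonovRapinchuk1994, §6.2] -/
theorem archPlaceChars_surjective : Function.Surjective (archPlaceChars L) := by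
  intro z
  refine ⟨⟨liftCircles L z, liftCircles_mem L z⟩, funext fun w => Circle.ext ?_⟩
  rw [archPlaceChars_apply, coe_archPlaceChar]
  exact extensionEmbedding_liftCircles L z w

/-- The joint weight map is a bijection `U(W)(L⁺ ⊗ ℝ) → ∏_w U(1)`. [cite: PlatonovRapinchuk1994, §6.2] -/
theorem archPlaceChars_bijective : Function.Bijective (archPlaceChars L) :=
  ⟨archPlaceChars_injective L, archPlaceChars_surjective L⟩

/-- **`U(W)(L⁺ ⊗ ℝ) ≅ ∏_{w ∣ ∞} U(1)` as groups.** [cite: PlatonovRapinchuk1994, §6.2] -/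
def relNormOneInfUnitsMulEquivCircles :
    relNormOneInfUnits (maximalRealSubfield L) L ≃* (InfinitePlace L → Circle) :=
  MulEquiv.ofBijective (archPlaceChars L) (archPlaceChars_bijective L)

/-- Values of the group isomorphism (the weight characters). [folklore] -/
@[simp] theorem relNormOneInfUnitsMulEquivCircles_apply (y : relNormOneInfUnits (maximalRealSubfield L) L) :
    relNormOneInfUnitsMulEquivCircles L y = archPlaceChars L y := rfl

/-- The group isomorphism is continuous. [folklore] -/
theorem continuous_relNormOneInfUnitsMulEquivCircles : Continuous (relNormOneInfUnitsMulEquivCircles L) :=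
  continuous_archPlaceChars L

/-- `U(W)(L⁺ ⊗ ℝ) ≃ₜ ∏_w U(1)`: the continuous bijection from the compact torus onto the Hausdorff product of circles
is a homeomorphism. [folklore] -/
def relNormOneInfUnitsHomeomorphCircles : relNormOneInfUnits (maximalRealSubfield L) L ≃ₜ (InfinitePlace L → Circle) :=
  Continuous.homeoOfEquivCompactToT2 (f := (relNormOneInfUnitsMulEquivCircles L).toEquiv)
    (continuous_relNormOneInfUnitsMulEquivCircles L)

/-- Values of the homeomorphism (the weight characters). [folklore] -/
@[simp] theorem relNormOneInfUnitsHomeomorphCircles_apply (y : relNormOneInfUnits (maximalRealSubfield L) L) :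
    relNormOneInfUnitsHomeomorphCircles L y = archPlaceChars L y := rfl

/-- **`U(W)(L⁺ ⊗ ℝ) ≅ ∏_{w ∣ ∞} U(1)` as topological groups.** [cite: PlatonovRapinchuk1994, §6.2] -/
def relNormOneInfUnitsEquivCircles : relNormOneInfUnits (maximalRealSubfield L) L ≃ₜ* (InfinitePlace L → Circle) :=
  { relNormOneInfUnitsMulEquivCircles L with
    continuous_toFun := (relNormOneInfUnitsHomeomorphCircles L).continuous
    continuous_invFun := (relNormOneInfUnitsHomeomorphCircles L).symm.continuous }

/-- Values of the topological-group isomorphism (the weight characters). [folklore] -/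
@[simp] theorem relNormOneInfUnitsEquivCircles_apply (y : relNormOneInfUnits (maximalRealSubfield L) L) :
    relNormOneInfUnitsEquivCircles L y = archPlaceChars L y := rfl

/-- The inverse isomorphism undoes the weight characters: `archPlaceChars (e⁻¹ z) = z`. [folklore] -/
@[simp] theorem archPlaceChars_relNormOneInfUnitsEquivCircles_symm (z : InfinitePlace L → Circle) :
    archPlaceChars L ((relNormOneInfUnitsEquivCircles L).symm z) = z :=
  (relNormOneInfUnitsEquivCircles L).apply_symm_apply z

/-- In particular the weight character at each place `w` is onto `U(1)`. [folklore] -/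
theorem archPlaceChar_surjective (w : InfinitePlace L) : Function.Surjective (archPlaceChar L w) := by
  classical
  intro c
  obtain ⟨y, hy⟩ := archPlaceChars_surjective L (Function.update (fun _ => 1) w c)
  exact ⟨y, by rw [← archPlaceChars_apply, hy, Function.update_self]⟩

end Circles

end Literature.NumberTheory.Automorphic

end
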